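import Summits.MatrixMultiplication.OmegaCensus.ThreeSetNoPartThreeGeneral
import Mathlib.GroupTheory.Exponent
import Mathlib.Tactic.IntervalCases

/-!
# No part of size three: consequences for small exponent, for `ℤ_n × ℤ_n` (all `n`), and for cube law triples (kernel)

ω-census `pub-omega`, family (b3), seat pub-omega-group gen 34.  Framing: lottery ticket; floor = certified bounds/negative
ranges.  VALUE: the headline corollaries of `ThreeSetNoPartThreeGeneral.card_le_of_cube_form_part_three` (a part of size `3`
in a cube symmetric form over a finite abelian group `A` forces `|A| ≤ 12·ord(w' − w) + 7`); NOT progress on ω and no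
census word changes.

* **`cube_form_card_ne_three_of_addOrderOf_le`**, **`cube_form_no_part_three_of_addOrderOf_le`**,
  `cube_form_no_part_three_of_exponent_lt` — if every element of `A` has order `≤ e` with `12e + 7 < |A|` (e.g.
  `12·exp(A) + 7 < |A|`), a cube symmetric form over `A` has no part of size `3`.
* **`cube_form_no_part_three_zmod_sq`** — over `ℤ_n × ℤ_n` for EVERY `n ∉ {8, 10}` no part has size `3`
  (`ThreeSetNoPartThree.cube_form_no_part_three`, g33, was the case `n` prime; `n ≥ 13`: orders `≤ n`; `n ≤ 12`:
  `9|X||Y| + 1 = n²` forces `n ∈ {1, 8, 10}`).  The two exceptions are genuine gaps of the method (`(3,1,7)@64`, `(3,1,11)@100`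
  would need `|#up − #down| ≤ n/3`-type bounds), not known forms.
* **`cube_law_no_coset_part_three_of_addOrderOf_le`**, `cube_law_no_coset_part_three_of_card_odd`,
  **`cube_law_no_coset_part_three_zmod_sq_odd`** — the corresponding statements for TPP triples with cube coset parts
  attaining `3|S||T||U| + 8 = 8|A|` in a dihedral-like group over `A` (`A` of odd order with `12·exp(A) + 7 < |A|`, resp.
  `A = ℤ_n × ℤ_n` for every odd `n` — g33 had `n` an odd prime), via `cube_symmetric_form_of_law` (g7).
-/

namespace Summit.MatrixMultiplication.OmegaCensus

open Finset

section Corollary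

variable {A : Type*} [AddCommGroup A] [DecidableEq A] [Fintype A]

/-- **No part of size three when all element orders are small**: if every element of `A` has order `≤ e` and
`12e + 7 < |A|`, then `|W| ≠ 3`. [folklore] -/
theorem cube_form_card_ne_three_of_addOrderOf_le {W X Y : Finset A} {x₀ : A}
    (h₁ : Set.InjOn (fun p : A × A × A => -p.1 + p.2.1 + p.2.2) ↑(W ×ˢ X ×ˢ Y))
    (h₂ : Set.InjOn (fun p : A × A × A => p.1 - p.2.1 + p.2.2) ↑(W ×ˢ X ×ˢ Y))
    (h₃ : Set.InjOn (fun p : A × A × A => p.1 + p.2.1 - p.2.2) ↑(W ×ˢ X ×ˢ Y))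
    (d₁₂ : Disjoint ((W ×ˢ X ×ˢ Y).image fun p : A × A × A => -p.1 + p.2.1 + p.2.2)
      ((W ×ˢ X ×ˢ Y).image fun p : A × A × A => p.1 - p.2.1 + p.2.2))
    (d₁₃ : Disjoint ((W ×ˢ X ×ˢ Y).image fun p : A × A × A => -p.1 + p.2.1 + p.2.2)
      ((W ×ˢ X ×ˢ Y).image fun p : A × A × A => p.1 + p.2.1 - p.2.2))
    (d₂₃ : Disjoint ((W ×ˢ X ×ˢ Y).image fun p : A × A × A => p.1 - p.2.1 + p.2.2)
      ((W ×ˢ X ×ˢ Y).image fun p : A × A × A => p.1 + p.2.1 - p.2.2))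
    (hcover : ((W ×ˢ X ×ˢ Y).image fun p : A × A × A => -p.1 + p.2.1 + p.2.2) ∪
      ((W ×ˢ X ×ˢ Y).image fun p : A × A × A => p.1 - p.2.1 + p.2.2) ∪
      ((W ×ˢ X ×ˢ Y).image fun p : A × A × A => p.1 + p.2.1 - p.2.2) = univ.erase x₀)
    (e : ℕ) (he : ∀ x : A, addOrderOf x ≤ e) (hA : 12 * e + 7 < Fintype.card A) : W.card ≠ 3 := by
  intro hW
  obtain ⟨w, w', w'', hww', -, -, hWeq⟩ := card_eq_three.1 hW
  have hw : w ∈ W := by rw [hWeq]; simp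
  have hw' : w' ∈ W := by rw [hWeq]; simp
  have h := card_le_of_cube_form_part_three h₁ h₂ h₃ d₁₂ d₁₃ d₂₃ hcover hW hw hw' hww'
  have := he (w' - w)
  omega

/-- All three parts: if every element of `A` has order `≤ e` and `12e + 7 < |A|`, a cube symmetric form over `A` has no part
of size `3`. [folklore] -/
theorem cube_form_no_part_three_of_addOrderOf_le {W X Y : Finset A} {x₀ : A}
    (h₁ : Set.InjOn (fun p : A × A × A => -p.1 + p.2.1 + p.2.2) ↑(W ×ˢ X ×ˢ Y))
    (h₂ : Set.InjOn (fun p : A × A × A => p.1 - p.2.1 + p.2.2) ↑(W ×ˢ X ×ˢ Y))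
    (h₃ : Set.InjOn (fun p : A × A × A => p.1 + p.2.1 - p.2.2) ↑(W ×ˢ X ×ˢ Y))
    (d₁₂ : Disjoint ((W ×ˢ X ×ˢ Y).image fun p : A × A × A => -p.1 + p.2.1 + p.2.2)
      ((W ×ˢ X ×ˢ Y).image fun p : A × A × A => p.1 - p.2.1 + p.2.2))
    (d₁₃ : Disjoint ((W ×ˢ X ×ˢ Y).image fun p : A × A × A => -p.1 + p.2.1 + p.2.2)
      ((W ×ˢ X ×ˢ Y).image fun p : A × A × A => p.1 + p.2.1 - p.2.2))
    (d₂₃ : Disjoint ((W ×ˢ X ×ˢ Y).image fun p : A × A × A => p.1 - p.2.1 + p.2.2)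
      ((W ×ˢ X ×ˢ Y).image fun p : A × A × A => p.1 + p.2.1 - p.2.2))
    (hcover : ((W ×ˢ X ×ˢ Y).image fun p : A × A × A => -p.1 + p.2.1 + p.2.2) ∪
      ((W ×ˢ X ×ˢ Y).image fun p : A × A × A => p.1 - p.2.1 + p.2.2) ∪
      ((W ×ˢ X ×ˢ Y).image fun p : A × A × A => p.1 + p.2.1 - p.2.2) = univ.erase x₀)
    (e : ℕ) (he : ∀ x : A, addOrderOf x ≤ e) (hA : 12 * e + 7 < Fintype.card A) :
    W.card ≠ 3 ∧ X.card ≠ 3 ∧ Y.card ≠ 3 := by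
  obtain ⟨i₁, i₂, i₃, e₁₂, e₁₃, e₂₃, ecov⟩ := cube_symmetric_form_rotate h₁ h₂ h₃ d₁₂ d₁₃ d₂₃ hcover
  obtain ⟨j₁, j₂, j₃, f₁₂, f₁₃, f₂₃, fcov⟩ := cube_symmetric_form_rotate i₁ i₂ i₃ e₁₂ e₁₃ e₂₃ ecov
  exact ⟨cube_form_card_ne_three_of_addOrderOf_le h₁ h₂ h₃ d₁₂ d₁₃ d₂₃ hcover e he hA,
    cube_form_card_ne_three_of_addOrderOf_le i₁ i₂ i₃ e₁₂ e₁₃ e₂₃ ecov e he hA,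
    cube_form_card_ne_three_of_addOrderOf_le j₁ j₂ j₃ f₁₂ f₁₃ f₂₃ fcov e he hA⟩

/-- **Exponent form.**  If `12·exp(A) + 7 < |A|` then a cube symmetric form over `A` has no part of size `3` — e.g.
`A = ℤ_m × ℤ_m'` with `m ∣ m'` and `12 m' + 7 < m m'`. [folklore] -/
theorem cube_form_no_part_three_of_exponent_lt {W X Y : Finset A} {x₀ : A}
    (h₁ : Set.InjOn (fun p : A × A × A => -p.1 + p.2.1 + p.2.2) ↑(W ×ˢ X ×ˢ Y))
    (h₂ : Set.InjOn (fun p : A × A × A => p.1 - p.2.1 + p.2.2) ↑(W ×ˢ X ×ˢ Y))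
    (h₃ : Set.InjOn (fun p : A × A × A => p.1 + p.2.1 - p.2.2) ↑(W ×ˢ X ×ˢ Y))
    (d₁₂ : Disjoint ((W ×ˢ X ×ˢ Y).image fun p : A × A × A => -p.1 + p.2.1 + p.2.2)
      ((W ×ˢ X ×ˢ Y).image fun p : A × A × A => p.1 - p.2.1 + p.2.2))
    (d₁₃ : Disjoint ((W ×ˢ X ×ˢ Y).image fun p : A × A × A => -p.1 + p.2.1 + p.2.2)
      ((W ×ˢ X ×ˢ Y).image fun p : A × A × A => p.1 + p.2.1 - p.2.2))
    (d₂₃ : Disjoint ((W ×ˢ X ×ˢ Y).image fun p : A × A × A => p.1 - p.2.1 + p.2.2)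
      ((W ×ˢ X ×ˢ Y).image fun p : A × A × A => p.1 + p.2.1 - p.2.2))
    (hcover : ((W ×ˢ X ×ˢ Y).image fun p : A × A × A => -p.1 + p.2.1 + p.2.2) ∪
      ((W ×ˢ X ×ˢ Y).image fun p : A × A × A => p.1 - p.2.1 + p.2.2) ∪
      ((W ×ˢ X ×ˢ Y).image fun p : A × A × A => p.1 + p.2.1 - p.2.2) = univ.erase x₀)
    (hA : 12 * AddMonoid.exponent A + 7 < Fintype.card A) : W.card ≠ 3 ∧ X.card ≠ 3 ∧ Y.card ≠ 3 :=
  cube_form_no_part_three_of_addOrderOf_le h₁ h₂ h₃ d₁₂ d₁₃ d₂₃ hcover (AddMonoid.exponent A)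
    (fun x => AddMonoid.addOrderOf_le_exponent AddMonoid.ExponentExists.of_finite x) hA

end Corollary

section Square

variable {n : ℕ} [NeZero n]

/-- In `ℤ_n × ℤ_n` every element has order at most `n`. [folklore] -/
theorem addOrderOf_le_of_zmod_sq (x : ZMod n × ZMod n) : addOrderOf x ≤ n := by
  have hn : 0 < n := Nat.pos_of_ne_zero (NeZero.ne n)
  refine Nat.le_of_dvd hn (addOrderOf_dvd_iff_nsmul_eq_zero.2 ?_)
  ext <;> simp [nsmul_eq_mul]

/-- **No part of size three over `ℤ_n × ℤ_n`, every `n ∉ {8, 10}`** (kernel; `ThreeSetNoPartThree.cube_form_no_part_three`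
was the case `n` prime).  For `n ≥ 13` by `cube_form_no_part_three_of_addOrderOf_le`; for `n ≤ 12` the counting identity
`9|X||Y| + 1 = n²` forces `n ∈ {1, 8, 10}`, and `n = 1` cannot hold three points. [folklore] -/
theorem cube_form_no_part_three_zmod_sq (hn8 : n ≠ 8) (hn10 : n ≠ 10) {W X Y : Finset (ZMod n × ZMod n)}
    {x₀ : ZMod n × ZMod n}
    (h₁ : Set.InjOn (fun q : (ZMod n × ZMod n) × (ZMod n × ZMod n) × (ZMod n × ZMod n) => -q.1 + q.2.1 + q.2.2)
      ↑(W ×ˢ X ×ˢ Y))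
    (h₂ : Set.InjOn (fun q : (ZMod n × ZMod n) × (ZMod n × ZMod n) × (ZMod n × ZMod n) => q.1 - q.2.1 + q.2.2)
      ↑(W ×ˢ X ×ˢ Y))
    (h₃ : Set.InjOn (fun q : (ZMod n × ZMod n) × (ZMod n × ZMod n) × (ZMod n × ZMod n) => q.1 + q.2.1 - q.2.2)
      ↑(W ×ˢ X ×ˢ Y))
    (d₁₂ : Disjoint ((W ×ˢ X ×ˢ Y).image fun q => -q.1 + q.2.1 + q.2.2) ((W ×ˢ X ×ˢ Y).image fun q => q.1 - q.2.1 + q.2.2))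
    (d₁₃ : Disjoint ((W ×ˢ X ×ˢ Y).image fun q => -q.1 + q.2.1 + q.2.2) ((W ×ˢ X ×ˢ Y).image fun q => q.1 + q.2.1 - q.2.2))
    (d₂₃ : Disjoint ((W ×ˢ X ×ˢ Y).image fun q => q.1 - q.2.1 + q.2.2) ((W ×ˢ X ×ˢ Y).image fun q => q.1 + q.2.1 - q.2.2))
    (hcover : ((W ×ˢ X ×ˢ Y).image fun q => -q.1 + q.2.1 + q.2.2) ∪ ((W ×ˢ X ×ˢ Y).image fun q => q.1 - q.2.1 + q.2.2) ∪
      ((W ×ˢ X ×ˢ Y).image fun q => q.1 + q.2.1 - q.2.2) = univ.erase x₀) :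
    W.card ≠ 3 ∧ X.card ≠ 3 ∧ Y.card ≠ 3 := by
  have hcard : Fintype.card (ZMod n × ZMod n) = n * n := by rw [Fintype.card_prod, ZMod.card]
  by_cases h13 : 13 ≤ n
  · exact cube_form_no_part_three_of_addOrderOf_le h₁ h₂ h₃ d₁₂ d₁₃ d₂₃ hcover n addOrderOf_le_of_zmod_sq
      (by rw [hcard]; nlinarith)
  · -- small `n`: the counting identity alone
    have key : ∀ {W' X' Y' : Finset (ZMod n × ZMod n)}, 3 * (W'.card * X'.card * Y'.card) + 1 = n * n →
        W'.card ≠ 3 := by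
      intro W' X' Y' hc hW'
      have hle : W'.card ≤ n * n := hcard ▸ card_le_univ W'
      rw [hW'] at hc hle
      have hn12 : n ≤ 12 := by omega
      have hc2 : 9 * (X'.card * Y'.card) + 1 = n * n := by rw [← hc]; ring
      generalize X'.card * Y'.card = m at hc2
      clear hc
      interval_cases n <;> omega
    obtain ⟨i₁, i₂, i₃, e₁₂, e₁₃, e₂₃, ecov⟩ := cube_symmetric_form_rotate h₁ h₂ h₃ d₁₂ d₁₃ d₂₃ hcover
    obtain ⟨j₁, j₂, j₃, f₁₂, f₁₃, f₂₃, fcov⟩ := cube_symmetric_form_rotate i₁ i₂ i₃ e₁₂ e₁₃ e₂₃ ecov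
    exact ⟨key (hcard ▸ three_mul_card_add_one_eq h₁ h₂ h₃ d₁₂ d₁₃ d₂₃ hcover),
      key (hcard ▸ three_mul_card_add_one_eq i₁ i₂ i₃ e₁₂ e₁₃ e₂₃ ecov),
      key (hcard ▸ three_mul_card_add_one_eq j₁ j₂ j₃ f₁₂ f₁₃ f₂₃ fcov)⟩

end Square

section Law

open Literature.Combinatorics.Additive

variable {A : Type*} [AddCommGroup A] [DecidableEq A] [Fintype A] {G : Type} [Group G] [DecidableEq G]
  {ρ τ : A → G} {c₀ : A} {S T U : Finset G}

/-- **No coset part of size three in a cube law triple when all element orders are small** (kernel).  Let `G` be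
dihedral-like over a finite abelian group `A` in which every element is a double (e.g. `|A|` odd), any `c₀`.  If every
element of `A` has order `≤ e` with `12e + 7 < |A|`, then a TPP triple with cube coset parts attaining `3|S||T||U| + 8 = 8|A|`
has no coset part of size `3`. [folklore] -/
theorem cube_law_no_coset_part_three_of_addOrderOf_le
    (hρρ : ∀ a b, ρ a * ρ b = ρ (a + b)) (hρτ : ∀ a b, ρ a * τ b = τ (b - a))
    (hτρ : ∀ a b, τ a * ρ b = τ (a + b)) (hττ : ∀ a b, τ a * τ b = ρ (c₀ + b - a))
    (hρ : Function.Injective ρ) (hτ : Function.Injective τ) (hne : ∀ a b, ρ a ≠ τ b)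
    (hsurj : ∀ g, (∃ a, ρ a = g) ∨ (∃ a, τ a = g)) (hhalf : ∀ c : A, ∃ a : A, a + a = c)
    (h : TripleProductProperty S T U)
    (hS : (univ.filter fun a : A => ρ a ∈ S).card = (univ.filter fun a : A => τ a ∈ S).card)
    (hT : (univ.filter fun a : A => ρ a ∈ T).card = (univ.filter fun a : A => τ a ∈ T).card)
    (hU : (univ.filter fun a : A => ρ a ∈ U).card = (univ.filter fun a : A => τ a ∈ U).card)
    (hV : 3 * (S.card * T.card * U.card) + 8 = 8 * Fintype.card A)
    (e : ℕ) (he : ∀ x : A, addOrderOf x ≤ e) (hA : 12 * e + 7 < Fintype.card A) :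
    (univ.filter fun a : A => ρ a ∈ S).card ≠ 3 ∧ (univ.filter fun a : A => ρ a ∈ T).card ≠ 3 ∧
      (univ.filter fun a : A => ρ a ∈ U).card ≠ 3 := by
  obtain ⟨W, X, Y, x₀, cW, cX, cY, i₁, i₂, i₃, e₁₂, e₁₃, e₂₃, ecov⟩ :=
    cube_symmetric_form_of_law hρρ hρτ hτρ hττ hρ hτ hne hsurj hhalf h hS hT hU hV
  obtain ⟨nW, nX, nY⟩ := cube_form_no_part_three_of_addOrderOf_le i₁ i₂ i₃ e₁₂ e₁₃ e₂₃ ecov e he hA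
  exact ⟨cW ▸ nW, cX ▸ nX, cY ▸ nY⟩

omit [DecidableEq A] in
/-- In a finite abelian group of odd order every element is a double (doubling is injective, hence onto). [folklore] -/
theorem exists_add_self_eq_of_card_odd (hodd : Odd (Fintype.card A)) (c : A) : ∃ a : A, a + a = c := by
  have hinj : Function.Injective fun a : A => a + a := by
    intro a b hab
    have hab' : a + a = b + b := hab
    have h2 : 2 • (a - b) = 0 := by rw [two_nsmul, sub_add_sub_comm, hab', sub_self]
    have hd := Nat.dvd_gcd (addOrderOf_dvd_of_nsmul_eq_zero h2) (addOrderOf_dvd_card (x := a - b))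
    rw [(Nat.coprime_two_left.2 hodd).gcd_eq_one, Nat.dvd_one, AddMonoid.addOrderOf_eq_one_iff, sub_eq_zero] at hd
    exact hd
  exact (Finite.injective_iff_surjective.1 hinj) c

/-- **Odd order, small exponent.**  For `G` dihedral-like over a finite abelian group `A` of ODD order with
`12·exp(A) + 7 < |A|` (any `c₀`): a TPP triple with cube coset parts attaining `3|S||T||U| + 8 = 8|A|` has no coset part of
size `3`. [folklore] -/
theorem cube_law_no_coset_part_three_of_card_odd (hodd : Odd (Fintype.card A))
    (hρρ : ∀ a b, ρ a * ρ b = ρ (a + b)) (hρτ : ∀ a b, ρ a * τ b = τ (b - a))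
    (hτρ : ∀ a b, τ a * ρ b = τ (a + b)) (hττ : ∀ a b, τ a * τ b = ρ (c₀ + b - a))
    (hρ : Function.Injective ρ) (hτ : Function.Injective τ) (hne : ∀ a b, ρ a ≠ τ b)
    (hsurj : ∀ g, (∃ a, ρ a = g) ∨ (∃ a, τ a = g))
    (h : TripleProductProperty S T U)
    (hS : (univ.filter fun a : A => ρ a ∈ S).card = (univ.filter fun a : A => τ a ∈ S).card)
    (hT : (univ.filter fun a : A => ρ a ∈ T).card = (univ.filter fun a : A => τ a ∈ T).card)
    (hU : (univ.filter fun a : A => ρ a ∈ U).card = (univ.filter fun a : A => τ a ∈ U).card)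
    (hV : 3 * (S.card * T.card * U.card) + 8 = 8 * Fintype.card A)
    (hA : 12 * AddMonoid.exponent A + 7 < Fintype.card A) :
    (univ.filter fun a : A => ρ a ∈ S).card ≠ 3 ∧ (univ.filter fun a : A => ρ a ∈ T).card ≠ 3 ∧
      (univ.filter fun a : A => ρ a ∈ U).card ≠ 3 :=
  cube_law_no_coset_part_three_of_addOrderOf_le hρρ hρτ hτρ hττ hρ hτ hne hsurj (exists_add_self_eq_of_card_odd hodd)
    h hS hT hU hV (AddMonoid.exponent A) (fun x => AddMonoid.addOrderOf_le_exponent AddMonoid.ExponentExists.of_finite x) hA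

/-- In `ℤ_n × ℤ_n` with `n` odd every element is a double. [folklore] -/
theorem exists_add_self_eq_of_odd {n : ℕ} [NeZero n] (hodd : Odd n) (c : ZMod n × ZMod n) :
    ∃ a : ZMod n × ZMod n, a + a = c := by
  have h2 : IsUnit (2 : ZMod n) := by
    have := (ZMod.isUnit_iff_coprime 2 n).2 (Nat.coprime_two_left.2 hodd)
    exact_mod_cast this
  obtain ⟨w, hw⟩ := h2
  refine ⟨((w⁻¹ : (ZMod n)ˣ) : ZMod n) • c, ?_⟩
  rw [← two_smul (ZMod n), smul_smul, ← hw, Units.mul_inv, one_smul]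

variable {n : ℕ} [NeZero n] {ρ' τ' : ZMod n × ZMod n → G} {c₀' : ZMod n × ZMod n}

/-- **No coset part of size three in a cube law triple over `Dih(ℤ_n²)`, every odd `n`** (kernel; g33 had `n` an odd prime).
Let `G` be dihedral-like over `ℤ_n × ℤ_n`, `n` odd (any presentation constant).  If a TPP triple `(S, T, U)` of `G` has cube
coset parts and attains `3|S||T||U| + 8 = 8n²`, then no coset part has size `3`. [folklore] -/
theorem cube_law_no_coset_part_three_zmod_sq_odd (hodd : Odd n)
    (hρρ : ∀ a b, ρ' a * ρ' b = ρ' (a + b)) (hρτ : ∀ a b, ρ' a * τ' b = τ' (b - a))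
    (hτρ : ∀ a b, τ' a * ρ' b = τ' (a + b)) (hττ : ∀ a b, τ' a * τ' b = ρ' (c₀' + b - a))
    (hρ : Function.Injective ρ') (hτ : Function.Injective τ') (hne : ∀ a b, ρ' a ≠ τ' b)
    (hsurj : ∀ g, (∃ a, ρ' a = g) ∨ (∃ a, τ' a = g))
    (h : TripleProductProperty S T U)
    (hS : (univ.filter fun a : ZMod n × ZMod n => ρ' a ∈ S).card =
      (univ.filter fun a : ZMod n × ZMod n => τ' a ∈ S).card)
    (hT : (univ.filter fun a : ZMod n × ZMod n => ρ' a ∈ T).card =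
      (univ.filter fun a : ZMod n × ZMod n => τ' a ∈ T).card)
    (hU : (univ.filter fun a : ZMod n × ZMod n => ρ' a ∈ U).card =
      (univ.filter fun a : ZMod n × ZMod n => τ' a ∈ U).card)
    (hV : 3 * (S.card * T.card * U.card) + 8 = 8 * Fintype.card (ZMod n × ZMod n)) :
    (univ.filter fun a : ZMod n × ZMod n => ρ' a ∈ S).card ≠ 3 ∧
      (univ.filter fun a : ZMod n × ZMod n => ρ' a ∈ T).card ≠ 3 ∧
      (univ.filter fun a : ZMod n × ZMod n => ρ' a ∈ U).card ≠ 3 := by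
  obtain ⟨W, X, Y, x₀, cW, cX, cY, i₁, i₂, i₃, e₁₂, e₁₃, e₂₃, ecov⟩ :=
    cube_symmetric_form_of_law hρρ hρτ hτρ hττ hρ hτ hne hsurj (exists_add_self_eq_of_odd hodd) h hS hT hU hV
  have hn8 : n ≠ 8 := by rintro rfl; exact absurd hodd (by decide)
  have hn10 : n ≠ 10 := by rintro rfl; exact absurd hodd (by decide)
  obtain ⟨nW, nX, nY⟩ := cube_form_no_part_three_zmod_sq hn8 hn10 i₁ i₂ i₃ e₁₂ e₁₃ e₂₃ ecov
  exact ⟨cW ▸ nW, cX ▸ nX, cY ▸ nY⟩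

end Law

end Summit.MatrixMultiplication.OmegaCensus
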